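import Summits.Ventures.CertifiedManyBodySolver.Certificates.HubRm2uTierP.Head
import Summits.Ventures.CertifiedManyBodySolver.Certificates.HubRm2uTierP.Hints022
import Summits.Ventures.CertifiedManyBodySolver.Rows.CorrWindowCertKernelChainQuotAdjFastBox

/-!
# tier-P instance (HubRm2u-R13-W3) — chain forest segment 101 of 102 (R-g4-19 SUFFIX RE-CUT from step 310 of the 96-segment parent edition; steps 346..348 from `[]`), file 1 of 1: steps 346..348 (topology (B): eval%-chained accumulators, import-serial INSIDE the segment only)

Generated by hubbard-algo-p2's untrusted exporter (emit_v0.py + emit_w3.py); every datum below is re-derived / re-checked by the kernel chain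
(`stepEQA`, Rows/CorrWindowCertKernelChainQuotAdj.lean) or is inert. HONEST FRAMING (xx1): instance data / kernel replay of a CONTROL/CALIBRATION
certificate (hub-Rm2-u′, 4^40-dyadic two-level Gram factors); nothing here is a theorem about the Hubbard model; no summit statement. [cite: Han2020Bootstrap, §3]
-/

set_option linter.style.longLine false
set_option maxRecDepth 100000
set_option maxHeartbeats 0

namespace Summit.Ventures.CertifiedManyBodySolver
namespace CARPolyWindow.TierP.HubRm2u
open Summit.Ventures.CertifiedQuantumChemistry Summit.Ventures.CertifiedQuantumChemistry.CARPoly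
open Literature.MathematicalPhysics.QuantumLattice Literature.MathematicalPhysics.QuantumLattice.HubbardWave0
open Literature.Probability.LatticeModels
open CARPolyWindow CARPolyWindow.BoxGeom

/-- segment 101 starts from the EMPTY accumulator before step 346 (chain forest, R-g4-11 (L6)). [folklore] -/
def C101_0 : SOSDual.EncPoly := []

/-- accumulator after step 347 within segment 101 (evaluated at elaboration; the kernel re-derives it in `step_346`). [folklore] -/
def C101_1 : SOSDual.EncPoly := eval% stepEQA D 2048 C101_0 (slices.getD 346 []) (hintsOfCodes Dr reps HC346)

/-- KERNEL FACT, step 346 of 350 (fast step (L7): `stepEQAFB_kernel`, box edition). [folklore] -/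
theorem step_346 : C101_1 = stepEQA D 2048 C101_0 (slices.getD 346 []) (hintsOfCodes Dr reps HC346) :=
  stepEQAFB_kernel 6 13 7 rfl (by decide +kernel)

/-- accumulator after step 348 within segment 101 (evaluated at elaboration; the kernel re-derives it in `step_347`). [folklore] -/
def C101_2 : SOSDual.EncPoly := eval% stepEQA D 2048 C101_1 (slices.getD 347 []) (hintsOfCodes Dr reps HC347)

/-- KERNEL FACT, step 347 of 350 (fast step (L7): `stepEQAFB_kernel`, box edition). [folklore] -/
theorem step_347 : C101_2 = stepEQA D 2048 C101_1 (slices.getD 347 []) (hintsOfCodes Dr reps HC347) :=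
  stepEQAFB_kernel 6 13 7 rfl (by decide +kernel)

/-- accumulator after step 349 within segment 101 (evaluated at elaboration; the kernel re-derives it in `step_348`). [folklore] -/
def C101_3 : SOSDual.EncPoly := eval% stepEQA D 2048 C101_2 (slices.getD 348 []) (hintsOfCodes Dr reps HC348)

/-- KERNEL FACT, step 348 of 350 (fast step (L7): `stepEQAFB_kernel`, box edition). [folklore] -/
theorem step_348 : C101_3 = stepEQA D 2048 C101_2 (slices.getD 348 []) (hintsOfCodes Dr reps HC348) :=
  stepEQAFB_kernel 6 13 7 rfl (by decide +kernel)


end CARPolyWindow.TierP.HubRm2u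
end Summit.Ventures.CertifiedManyBodySolver
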